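import Summits.QuantumAdvantage.QuantumAdvantage.Theses.WhiteBoxWalk
import Literature.Computability.Complexity.RandomizedProofs
import Literature.Computability.Complexity.PCPProofs

/-!
# `WbwObfuscatedGluedTrees` (stmt-QuantumAdvantage-2340) — V: typed traps for the generator (the answer must never default)

Support / negative lemmas for the INFORMAL crux `WbwObfuscatedGluedTrees` of route
`Summits/QuantumAdvantage/QuantumAdvantage/Theses/WhiteBoxWalk`, extracted from the refuter work file
`Summits/QuantumAdvantage/QuantumAdvantage/Cruxes/WbwObfuscatedGluedTrees/Disproof.lean` (§0b, cycle 1;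
filed in cycle 2 by refuter-cdisprove-stmt-QuantumAdvantage-2340-g2-0). Self-contained on the route
file's vocabulary (no new definition): the clause refuted below is LITERALLY clause (C) of
`WbwThesis` for a fixed pair `(gen, ans)` — the body of `ClauseC gen ans` of `LoadBearing.lean` (I),
which unfolds to it by `Iff.rfl`. Sorry-free; no Theses decl is asserted: the theorems REFUTE
clause (C) for a class of sloppy typings of the requested definition `obfuscatedGluedTreesGen`, they
do not touch the intended generator.

Clause (C) averages over ALL seeds `s ∈ {0,1}ⁿ` for EVERY `n` and asks for superpolynomial decay
along `n → ∞`. A generator that parses `s = (k, coins)` only for lengths of a special form and sets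
`ans s` to a FIXED string (e.g. `[]`) on malformed seeds makes (C) FALSE: the coin-free constant
algorithm wins with probability `1` at those lengths (`clauseC_false_of_ans_const_frequently`,
`clauseC_false_of_ans_nil_frequently`; workhorse `not_superpolynomialDecay_of_frequently_le`). So the
typed generator must stretch EVERY seed of EVERY length into keys and coins (PRG/KDF) and never
branch to a trivial answer.
-/

set_option linter.dupNamespace false

namespace Summit.QuantumAdvantage.QuantumAdvantage.Theorems.WbwObfuscatedGluedTrees.Negative

open Literature.Computability.Cryptography Literature.Computability.Complexity
open Filter Asymptotics

/-- **Workhorse.** A sequence that is `≥ c > 0` infinitely often does not decay superpolynomially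
(it does not even tend to `0`). [folklore] -/
theorem not_superpolynomialDecay_of_frequently_le {f : ℕ → ℝ} {c : ℝ} (hc : 0 < c)
    (h : ∃ᶠ n in atTop, c ≤ f n) : ¬ SuperpolynomialDecay atTop (fun n : ℕ => (n : ℝ)) f := by
  intro hdec
  have htend : Tendsto f atTop (nhds 0) := by simpa using hdec 0
  have hev : ∀ᶠ n : ℕ in atTop, f n < c := htend.eventually (gt_mem_nhds hc)
  obtain ⟨n, hn, hlt⟩ := (h.and_eventually hev).exists
  exact absurd hlt (not_lt.2 hn)

/-- **Trap (refutes a sloppy typing, not the mechanism).** If for infinitely many lengths `n` every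
seed of length `n` has the SAME answer `a₀`, clause (C) of `WbwThesis` for `(gen, ans)` fails: the
constant PPT algorithm outputting `a₀` succeeds with probability `1` at those lengths. The refuted
clause is verbatim the body of `LoadBearing.lean`'s `ClauseC gen ans`. [folklore] -/
theorem clauseC_false_of_ans_const_frequently (gen ans : List Bool → List Bool) (a₀ : List Bool)
    (h : ∃ᶠ n in atTop, ∀ s : List Bool, s.length = n → ans s = a₀) :
    ¬ ∀ A : RandAlg (List Bool) (List Bool), IsPPT A id →
      SuperpolynomialDecay atTop (fun n : ℕ => (n : ℝ)) (fun n : ℕ =>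
        uniformAvg n fun s => A.pr id (boolPair (Computability.unaryEncodeNat n) (gen s))
          {y | ans s <+: y}) := by
  classical
  intro hC
  set A : RandAlg (List Bool) (List Bool) := RandAlg.ofDet fun _ => a₀ with hA
  have hPPT : IsPPT A id :=
    RandAlg.IsPolyTime.ofDet_holds (PolyTimeComputable.const _ _ a₀)
  refine not_superpolynomialDecay_of_frequently_le one_pos (h.mono fun n hn => ?_) (hC A hPPT)
  have hpr : ∀ s : List Bool, s.length = n →
      A.pr id (boolPair (Computability.unaryEncodeNat n) (gen s)) {y | ans s <+: y} = 1 := by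
    intro s hs
    rw [hA, RandAlg.pr_ofDet]
    simp [hn s hs]
  simp only [uniformAvg]
  rw [Finset.sum_congr rfl fun (x : List.Vector Bool n) _ => hpr x.toList (by simp)]
  simp [card_vector]

/-- The trap for the EMPTY default answer (`[] <+: y` for every output `y`): if on infinitely many
lengths every seed gets `ans s = []`, clause (C) fails. [folklore] -/
theorem clauseC_false_of_ans_nil_frequently (gen ans : List Bool → List Bool)
    (h : ∃ᶠ n in atTop, ∀ s : List Bool, s.length = n → ans s = []) :
    ¬ ∀ A : RandAlg (List Bool) (List Bool), IsPPT A id →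
      SuperpolynomialDecay atTop (fun n : ℕ => (n : ℝ)) (fun n : ℕ =>
        uniformAvg n fun s => A.pr id (boolPair (Computability.unaryEncodeNat n) (gen s))
          {y | ans s <+: y}) :=
  clauseC_false_of_ans_const_frequently gen ans [] h

/-- **Consequence for `WbwThesis` witnesses**: no pair `(gen, ans)` whose answer is constant on all
seeds of infinitely many lengths can witness the thesis (its clause (C) conjunct fails), whatever
`gen`, the polynomial and the quantum family are. [folklore] -/
theorem not_wbwThesis_witness_of_ans_const_frequently (gen ans : List Bool → List Bool)
    (a₀ : List Bool) (h : ∃ᶠ n in atTop, ∀ s : List Bool, s.length = n → ans s = a₀) :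
    ¬ (PolyTimeComputable id id gen ∧
      (∃ p : Polynomial ℕ, ∀ s, (ans s).length = p.eval (gen s).length) ∧
      (∃ F : QCircuitFamily cliffordT, F.IsOracleFree ∧ F.IsUniform ∧
        ∀ s, 2 / 3 ≤ F.kernelProb 0 (gen s) {y | ans s <+: y}) ∧
      ∀ A : RandAlg (List Bool) (List Bool), IsPPT A id →
        SuperpolynomialDecay atTop (fun n : ℕ => (n : ℝ)) (fun n : ℕ =>
          uniformAvg n fun s => A.pr id (boolPair (Computability.unaryEncodeNat n) (gen s))
            {y | ans s <+: y})) :=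
  fun hw => clauseC_false_of_ans_const_frequently gen ans a₀ h hw.2.2.2

end Summit.QuantumAdvantage.QuantumAdvantage.Theorems.WbwObfuscatedGluedTrees.Negative
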